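import Literature.NumberTheory.EllipticCurves.CanonicalPAdicHeightSqOfPairThetaProofs
import HarnessLib

/-!
# The sigma-squared height of a GIVEN pair: the reduction-kernel locus, its torsion, the parallelogram
# law and the height datum (proofs only)

Topic `Literature/NumberTheory/EllipticCurves` (trunk T-NT-EC). Pure proof file (no definition, no
named fact), sequel of `CanonicalPAdicHeightSqOfPairThetaProofs.lean` and twin of
`CanonicalPAdicHeightSqExistenceProofs.lean` for an ARBITRARY sigma-squared pair `(Σ, c)` of `W ⊗ ℚ_p`
instead of the chosen `padicSigmaSq`. Width seat `bsd-line-cf2-p1-w5` (g20) of the cell `bsd-print-cf2`,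
in support of stmt-BirchSwinnertonDyer-20368 (road (C), the pinning stub `stub_pin_minusTwist_two`).
BSD is not proved by any of this.

* §1 `some_mem_comap_toPadicPoint_formalFiltration_one_iff`, `exists_addSubgroup_mem_iff_kernelLocus` —
  **`{O} ∪ {(x,y) : ‖x‖_p > 1, non-singular reduction at every prime}` is a subgroup of `E(ℚ)`**, with
  NO sigma-disc condition (at `p = 2` the tree's local-conditions locus is the smaller `Ê(4ℤ₂)`-locus);
* §2 `not_isOfFinAddOrder_of_one_lt_norm_of_a₁_a₃` — for a `ℤ`-integral model with `a₁ = a₃ = 0` that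
  locus is torsion-free at EVERY prime, `2` included (a rational `2`-torsion point is `(x₀, 0)`, `x₀` a
  root of the MONIC integral cubic `x³ + a₂x² + a₄x + a₆`, so `‖x₀‖_p ≤ 1`);
* §3 `parallelogram_of_pair` — the `Σ`-height `q = log_p den x − log_p Σ(z)` of any pair is quadratic on
  generic pairs of the locus (theta of the pair + Néron's denominator law);
* §4 `exists_padicHeightData_of_pair`, `exists_padicHeightData_of_pair_of_a₁_a₃` — a symmetric
  bilinear torsion-vanishing `D : E(ℚ) × E(ℚ) → ℚ_p` with `D(P,P) = q(P)` on the locus, `q` an explicit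
  ARGUMENT constrained only there (consumers pass the function they want pinned, e.g. the minus-twist
  receptacle `canonicalPAdicHeightSqMinusTwist` read through a `ℚ`-isomorphism).

## Sources

* B. Mazur, W. Stein, J. Tate, Doc. Math. Extra Vol. Coates (2006), §1 («extends uniquely»), §2.6–2.7.
  [MazurSteinTate2006]
* W. Stein, C. Wuthrich, Math. Comp. 82 (2013), §4.1 eq. (4.1). [SteinWuthrich2013]
* J. H. Silverman, Math. Ann. 332 (2005), §5 Rem. 2. [Silverman2005DivPoly]
* J. H. Silverman, *The Arithmetic of Elliptic Curves*, 2nd ed. (2009), IV.3, IV.6.1, VII.2.1–2.2,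
  VII.3.4. [SilvermanAEC2009]
-/

noncomputable section

open scoped Classical
open PowerSeries Literature.NumberTheory.EllipticCurves

namespace WeierstrassCurve

/-! ### §1 The reduction-kernel locus `{O} ∪ {‖x‖_p > 1, non-singular reduction everywhere}` -/

section Locus

variable (W : WeierstrassCurve ℚ) [W.IsElliptic] [W.IsIntegral ℤ] (p : ℕ) [Fact p.Prime]

variable {W p} in
/-- **`E(ℚ) ∩ E₁(ℚ_p)` in coordinates**: a rational affine point lies in the pull-back of `E₁(ℚ_p) = Ê(pℤ_p)`
(`formalFiltration 1`) iff `‖x‖_p > 1` — then automatically `‖z‖_p ≤ p⁻¹` (`3v(x) = 2v(y)`, AEC VII.2.2).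
[Silverman AEC VII.2.2, IV.3] [cite: SilvermanAEC2009, VII.2.2] -/
theorem some_mem_comap_toPadicPoint_formalFiltration_one_iff {x y : ℚ} (h : W.toAffine.Nonsingular x y) :
    (.some x y h : W.toAffine.Point) ∈
        ((W.baseChange ℚ_[p]).formalFiltration 1).comap (W.toPadicPoint p) ↔ 1 < ‖(x : ℚ_[p])‖ := by
  rw [some_mem_comap_toPadicPoint_formalFiltration_iff]
  refine ⟨fun h' => h'.1, fun hx => ⟨hx, ?_⟩⟩
  obtain ⟨-, -, hz1, -, -⟩ := (W.baseChange ℚ_[p]).param_facts (nonsingular_ratCast (p := p) h).1 hx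
  rw [pow_one, ← zpow_neg_one]
  have : ‖-(x : ℚ_[p]) / y‖ < (p : ℝ) ^ ((-1 : ℤ) + 1) := by rw [neg_add_cancel, zpow_zero]; exact hz1
  exact (Padic.norm_le_pow_iff_norm_lt_pow_add_one _ _).mpr this

/-- **The reduction-kernel locus with `O` is a subgroup of `E(ℚ)`** (any prime `p`, `ℤ`-integral equation):
`{O} ∪ {(x, y) : ‖x‖_p > 1, non-singular reduction at every prime}` is the underlying set of
`toPadicPoint⁻¹(E₁(ℚ_p)) ⊓ ⨅_ℓ E₀(ℚ) at ℓ` — the tree's local-conditions locus WITHOUT the sigma-disc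
condition (which at `p = 2` cuts `Ê(2ℤ₂)` down to `Ê(4ℤ₂)`). [Silverman AEC VII.2.1, VII.2.2]
[cite: SilvermanAEC2009, VII.2.1] -/
theorem exists_addSubgroup_mem_iff_kernelLocus :
    ∃ H : AddSubgroup W.toAffine.Point, ∀ P : W.toAffine.Point, P ∈ H ↔
      P = 0 ∨ ∃ (x y : ℚ) (h : W.toAffine.Nonsingular x y), P = .some x y h ∧ 1 < ‖(x : ℚ_[p])‖ ∧
        ∀ ℓ : ℕ, ℓ.Prime → W.HasNonsingularReductionAt ℓ x y := by
  refine ⟨((W.baseChange ℚ_[p]).formalFiltration 1).comap (W.toPadicPoint p) ⊓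
    ⨅ ℓ : Nat.Primes, (haveI : Fact ℓ.1.Prime := ⟨ℓ.2⟩; W.nonsingularReductionSubgroupAt ℓ.1), fun P => ?_⟩
  rw [AddSubgroup.mem_inf, AddSubgroup.mem_iInf]
  rcases P with _ | ⟨x, y, h⟩
  · simp only [WeierstrassCurve.Affine.Point.zero_def, true_or, iff_true]
    exact ⟨AddSubgroup.zero_mem _, fun ℓ => AddSubgroup.zero_mem _⟩
  · rw [some_mem_comap_toPadicPoint_formalFiltration_one_iff]
    constructor
    · rintro ⟨hx, hns⟩
      refine Or.inr ⟨x, y, h, rfl, hx, fun ℓ hℓ => ?_⟩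
      haveI : Fact ℓ.Prime := ⟨hℓ⟩
      exact (mem_nonsingularReductionSubgroupAt_iff _).mp (hns ⟨ℓ, hℓ⟩)
    · rintro (h0 | ⟨x', y', h', he, hx, hns⟩)
      · exact (WeierstrassCurve.Affine.Point.some_ne_zero h h0).elim
      · obtain ⟨rfl, rfl⟩ : x = x' ∧ y = y' := by
          simpa using he
        exact ⟨hx, fun ℓ => by
          haveI : Fact ℓ.1.Prime := ⟨ℓ.2⟩
          exact (mem_nonsingularReductionSubgroupAt_iff _).mpr (hns ℓ.1 ℓ.2)⟩

end Locus

/-! ### §2 Torsion in `E(ℚ) ∩ E₁(ℚ_p)` for a model with `a₁ = a₃ = 0` -/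

section Torsion

variable {W : WeierstrassCurve ℚ} [W.IsElliptic] [W.IsIntegral ℤ] {p : ℕ} [Fact p.Prime]

/-- **For a `ℤ`-integral model with `a₁ = a₃ = 0`, `E(ℚ) ∩ E₁(ℚ_p)` is torsion-free at EVERY prime,
`p = 2` included** (no sigma-disc condition): prime-to-`p`… more precisely, a torsion point `(x, y)` with
`‖x‖_p > 1` would have a multiple of prime order `q` in `E₁(ℚ_p)`; for `q` odd (or `p ≥ 3`) this
contradicts `val_le_one_of_zsmul_eq_zero` / AEC VII.3.4, and a point of order `2` is `(x₀, 0)` with `x₀` a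
root of the MONIC integral cubic `x³ + a₂x² + a₄x + a₆`, so `‖x₀‖_p ≤ 1`. (For general `a₁, a₃` the
`2`-torsion of `Ê(2ℤ₂)` can be non-trivial, AEC IV.6.1.) [Silverman AEC VII.3.4, IV.6.1, IV.3.2(b)]
[cite: SilvermanAEC2009, VII.3.4] -/
theorem not_isOfFinAddOrder_of_one_lt_norm_of_a₁_a₃ (ha₁ : W.a₁ = 0) (ha₃ : W.a₃ = 0) {x y : ℚ}
    (h : W.toAffine.Nonsingular x y) (hx : 1 < ‖(x : ℚ_[p])‖) :
    ¬ IsOfFinAddOrder (.some x y h : W.toAffine.Point) := by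
  by_cases hp2 : p ≠ 2
  · exact not_isOfFinAddOrder_of_one_lt_norm (by have := (Fact.out : p.Prime).two_le; omega) h hx
  rw [not_ne_iff] at hp2
  subst hp2
  intro hfin
  have hprime : (2 : ℕ).Prime := Fact.out
  -- the subgroup `E(ℚ) ∩ E₁(ℚ₂)`
  set H := ((W.baseChange ℚ_[2]).formalFiltration 1).comap (W.toPadicPoint 2) with hHdef
  have hPmem : (.some x y h : W.toAffine.Point) ∈ H :=
    (some_mem_comap_toPadicPoint_formalFiltration_one_iff h).mpr hx
  -- a multiple of prime order, still in `H`
  set P : W.toAffine.Point := .some x y h with hPdef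
  have hN : 0 < addOrderOf P := hfin.addOrderOf_pos
  have hN1 : addOrderOf P ≠ 1 := by
    rw [Ne, AddMonoid.addOrderOf_eq_one_iff]; exact WeierstrassCurve.Affine.Point.some_ne_zero h
  obtain ⟨q, hq, hqN⟩ := Nat.exists_prime_and_dvd hN1
  obtain ⟨m, hm⟩ := hqN
  have hm0 : m ≠ 0 := by rintro rfl; rw [mul_zero] at hm; omega
  have hmlt : m < addOrderOf P := by
    rw [hm]; exact lt_mul_left (Nat.pos_of_ne_zero hm0) hq.one_lt
  have hRmem := AddSubgroup.nsmul_mem _ hPmem m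
  set R := m • P with hRdef
  have hR0 : R ≠ 0 := nsmul_ne_zero_of_lt_addOrderOf hm0 hmlt
  have hqR : q • R = 0 := by
    rw [hRdef, ← mul_nsmul, Nat.mul_comm m q, ← hm]; exact addOrderOf_nsmul_eq_zero P
  rcases hR : R with _ | ⟨x', y', h'⟩
  · exact hR0 hR
  rw [hR] at hRmem hqR
  have hx' := (some_mem_comap_toPadicPoint_formalFiltration_one_iff h').mp hRmem
  by_cases hq2 : q = 2
  · -- `q = 2`: `R = -R`, so `y' = 0` and `x'³ + a₂x'² + a₄x' + a₆ = 0` with `‖x'‖₂ > 1`: impossible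
    subst hq2
    have hneg : (.some x' y' h' : W.toAffine.Point) = -(.some x' y' h') := by
      rw [eq_neg_iff_add_eq_zero, ← two_nsmul]; exact hqR
    rw [Affine.Point.neg_some, Affine.Point.some.injEq] at hneg
    have hy' : y' = 0 := by
      have e := hneg.2
      rw [Affine.negY, ha₁, ha₃] at e
      linarith
    have heq := h'.1
    rw [Affine.equation_iff, ha₁, ha₃, hy'] at heq
    -- `x'³ = -(a₂x'² + a₄x' + a₆)` in `ℚ₂`
    have heq' : (x' : ℚ_[2]) ^ 3 = -((W.a₂ : ℚ_[2]) * (x' : ℚ_[2]) ^ 2 + (W.a₄ : ℚ_[2]) * x' + W.a₆) := by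
      have := congrArg (fun q : ℚ => (q : ℚ_[2])) heq
      push_cast at this ⊢
      linear_combination -this
    obtain ⟨-, h₂, -, h₄, h₆⟩ := (W.baseChange ℚ_[2]).norm_coeffs_le_one
    simp only [baseChange, map_a₂, map_a₄, map_a₆, eq_ratCast] at h₂ h₄ h₆
    have hx0 : 0 < ‖(x' : ℚ_[2])‖ := one_pos.trans hx'
    have hbound : ‖(W.a₂ : ℚ_[2]) * (x' : ℚ_[2]) ^ 2 + (W.a₄ : ℚ_[2]) * x' + W.a₆‖ ≤ ‖(x' : ℚ_[2])‖ ^ 2 := by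
      refine (IsUltrametricDist.norm_add_le_max _ _).trans (max_le ?_ ?_)
      · refine (IsUltrametricDist.norm_add_le_max _ _).trans (max_le ?_ ?_)
        · rw [norm_mul, norm_pow]
          exact mul_le_of_le_one_left (pow_nonneg (norm_nonneg _) 2) h₂
        · rw [norm_mul]
          calc ‖(W.a₄ : ℚ_[2])‖ * ‖(x' : ℚ_[2])‖ ≤ 1 * ‖(x' : ℚ_[2])‖ :=
                mul_le_mul_of_nonneg_right h₄ (norm_nonneg _)
            _ ≤ ‖(x' : ℚ_[2])‖ ^ 2 := by rw [one_mul, sq]; exact le_mul_of_one_le_left hx0.le hx'.le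
      · calc ‖(W.a₆ : ℚ_[2])‖ ≤ 1 := h₆
          _ ≤ ‖(x' : ℚ_[2])‖ ^ 2 := one_le_pow₀ hx'.le
    have h3 : ‖(x' : ℚ_[2])‖ ^ 3 ≤ ‖(x' : ℚ_[2])‖ ^ 2 := by
      rw [← norm_pow, heq', norm_neg]; exact hbound
    have : ‖(x' : ℚ_[2])‖ ^ 2 * ‖(x' : ℚ_[2])‖ ≤ ‖(x' : ℚ_[2])‖ ^ 2 * 1 := by
      rw [mul_one, ← pow_succ]; exact h3
    exact absurd (le_of_mul_le_mul_left this (pow_pos hx0 2)) (not_le.mpr hx')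
  · -- `q` odd: `ΨSq_q` has unit leading coefficient
    haveI : W.IsIntegral (ratAdicValuation 2).integer := W.isIntegral_integer_ratAdicValuation 2
    have hqR' : (q : ℤ) • (.some x' y' h' : W.toAffine.Point) = 0 := by rw [natCast_zsmul]; exact hqR
    have hqR'' := (point_zsmul_irrel (instDecidableEqRat) (fun a b => Classical.propDecidable (a = b))
      (q : ℤ) (.some x' y' h' : W.toAffine.Point)).symm.trans hqR'
    have hwq : ratAdicValuation 2 ((q : ℤ) : ℚ) = 1 := by
      rw [ratAdicValuation_apply, ← NNReal.coe_eq_one, coe_nnnorm, Int.cast_natCast, Rat.cast_natCast,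
        Padic.norm_natCast_eq_one_iff]
      exact (Nat.coprime_primes hprime hq).mpr (Ne.symm hq2)
    have := Literature.NumberTheory.EllipticCurves.val_le_one_of_zsmul_eq_zero (V := W) hwq hqR''
    rw [ratAdicValuation_apply, ← NNReal.coe_le_coe, NNReal.coe_one, coe_nnnorm] at this
    exact absurd hx' (not_lt.mpr this)

end Torsion

/-! ### §3 The parallelogram law of the `Σ`-height of a given pair on the reduction-kernel locus -/

section Parallelogram

variable {W : WeierstrassCurve ℚ} [W.IsElliptic] [W.IsIntegral ℤ] {p : ℕ} [Fact p.Prime]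

/-- **The `Σ`-height `q(P) = log_p den x(P) − log_p Σ(z(P))` of ANY sigma-squared pair `(Σ, c)` of
`W ⊗ ℚ_p` satisfies the parallelogram law on generic pairs of the reduction-kernel locus**: for
`P = (x₁,y₁)`, `Q = (x₂,y₂) ∈ E(ℚ)` with `‖xᵢ‖_p > 1`, non-singular reduction at every prime, and `P ≠ ±Q`,
`q(P+Q) + q(P−Q) = 2q(P) + 2q(Q)` — from the squared theta relation of the pair
(`padicEval_theta_of_pair`), Néron's denominator law `d₃d₄ = d₁²d₂²δ²` (`den_mul_den_eq`) and
`log_p(ab) = log_p a + log_p b`. No sigma-disc condition is needed (the disc only serves torsion-freeness).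
This is Mazur–Stein–Tate's «`h_ρ` is quadratic because of property IV of `σ`», for `Σ` instead of the
chosen `padicSigmaSq`. [Mazur–Stein–Tate 2006, §2.6–2.7; Stein–Wuthrich 2013, §4.1 eq. (4.1)]
[cite: MazurSteinTate2006, §2.7] -/
theorem parallelogram_of_pair {Sq : ℚ_[p]⟦X⟧} {c : ℚ_[p]}
    (hpair : (W.baseChange ℚ_[p]).IsMazurTateSigmaSqPair Sq c) (q : W.toAffine.Point → ℚ_[p])
    (hq : ∀ (x y : ℚ) (h : W.toAffine.Nonsingular x y), 1 < ‖(x : ℚ_[p])‖ →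
      q (.some x y h) = padicLog p ((x.den : ℚ) : ℚ_[p]) - padicLog p (padicEval Sq (-(x : ℚ_[p]) / y)))
    {x₁ y₁ x₂ y₂ : ℚ} (h₁ : W.toAffine.Nonsingular x₁ y₁) (h₂ : W.toAffine.Nonsingular x₂ y₂)
    (hx₁ : 1 < ‖(x₁ : ℚ_[p])‖) (hx₂ : 1 < ‖(x₂ : ℚ_[p])‖)
    (hns₁ : ∀ ℓ : ℕ, ℓ.Prime → W.HasNonsingularReductionAt ℓ x₁ y₁)
    (hns₂ : ∀ ℓ : ℕ, ℓ.Prime → W.HasNonsingularReductionAt ℓ x₂ y₂)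
    (hsub : (.some x₁ y₁ h₁ : W.toAffine.Point) - .some x₂ y₂ h₂ ≠ 0)
    (hadd : (.some x₁ y₁ h₁ : W.toAffine.Point) + .some x₂ y₂ h₂ ≠ 0) :
    q (.some x₁ y₁ h₁ + .some x₂ y₂ h₂) + q (.some x₁ y₁ h₁ - .some x₂ y₂ h₂) =
      2 * q (.some x₁ y₁ h₁) + 2 * q (.some x₂ y₂ h₂) := by
  have hmul : padicLog_mul p := padicLog_mul_holds p
  have hden : padicValNat_den_parallelogram := padicValNat_den_parallelogram_holds
  -- the subgroup: `P ± Q` again lie in the locus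
  obtain ⟨H, hH⟩ := W.exists_addSubgroup_mem_iff_kernelLocus p
  have hmem : ∀ {x y : ℚ} (h : W.toAffine.Nonsingular x y), (.some x y h : W.toAffine.Point) ∈ H ↔
      1 < ‖(x : ℚ_[p])‖ ∧ ∀ ℓ : ℕ, ℓ.Prime → W.HasNonsingularReductionAt ℓ x y := by
    intro x y h
    rw [hH]
    constructor
    · rintro (h0 | ⟨x', y', h', he, hx, hns⟩)
      · exact (WeierstrassCurve.Affine.Point.some_ne_zero h h0).elim
      · obtain ⟨rfl, rfl⟩ : x = x' ∧ y = y' := by simpa using he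
        exact ⟨hx, hns⟩
    · rintro ⟨hx, hns⟩
      exact Or.inr ⟨x, y, h, rfl, hx, hns⟩
  have hPH := (hmem h₁).mpr ⟨hx₁, hns₁⟩
  have hQH := (hmem h₂).mpr ⟨hx₂, hns₂⟩
  have hSH := H.add_mem hPH hQH
  have hDH := H.sub_mem hPH hQH
  -- coordinates of the four points
  have hx : x₁ ≠ x₂ := X_ne_of_sub_ne_zero_of_add_ne_zero h₁ h₂ hsub hadd
  rcases hS : (.some x₁ y₁ h₁ : W.toAffine.Point) + .some x₂ y₂ h₂ with _ | ⟨x₃, y₃, h₃⟩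
  · exact (hadd hS).elim
  rcases hD : (.some x₁ y₁ h₁ : W.toAffine.Point) - .some x₂ y₂ h₂ with _ | ⟨x₄, y₄, h₄⟩
  · exact (hsub hD).elim
  rw [hS] at hSH
  rw [hD] at hDH
  obtain ⟨hx₃, hns₃⟩ := (hmem h₃).mp hSH
  obtain ⟨hx₄, hns₄⟩ := (hmem h₄).mp hDH
  -- the squared theta relation and the denominator identity
  have hθ' := W.padicEval_theta_of_pair p hpair h₁ h₂ hx₁ hx₂
  rw [hS, hD] at hθ'
  simp only [padicParam_some] at hθ'
  have hden' := den_mul_den_eq hden W h₁ h₂ h₃ h₄ hx hS hD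
    fun ℓ hℓ => ⟨hns₁ ℓ hℓ, hns₂ ℓ hℓ, hns₃ ℓ hℓ, hns₄ ℓ hℓ⟩
  have hdenp : ((x₃.den : ℚ) : ℚ_[p]) * ((x₄.den : ℚ) : ℚ_[p]) =
      ((x₁.den : ℚ) : ℚ_[p]) ^ 2 * ((x₂.den : ℚ) : ℚ_[p]) ^ 2 * ((x₁ : ℚ_[p]) - x₂) ^ 2 := by
    have := congrArg (fun q : ℚ => (q : ℚ_[p])) hden'
    push_cast at this ⊢
    exact this
  -- non-vanishing
  have hS₁ := W.padicEval_pair_param_ne_zero p hpair h₁ hx₁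
  have hS₂ := W.padicEval_pair_param_ne_zero p hpair h₂ hx₂
  have hS₃ := W.padicEval_pair_param_ne_zero p hpair h₃ hx₃
  have hS₄ := W.padicEval_pair_param_ne_zero p hpair h₄ hx₄
  have hd : ∀ x : ℚ, ((x.den : ℚ) : ℚ_[p]) ≠ 0 := fun x => by exact_mod_cast x.den_nz
  have hδ : (x₁ : ℚ_[p]) - x₂ ≠ 0 := sub_ne_zero.mpr (by exact_mod_cast hx)
  have hδ' : (x₂ : ℚ_[p]) - x₁ ≠ 0 := by rw [← neg_sub]; exact neg_ne_zero.mpr hδ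
  -- logarithms
  have hlogd : padicLog p ((x₃.den : ℚ) : ℚ_[p]) + padicLog p ((x₄.den : ℚ) : ℚ_[p]) =
      2 * padicLog p ((x₁.den : ℚ) : ℚ_[p]) + 2 * padicLog p ((x₂.den : ℚ) : ℚ_[p]) +
        2 * padicLog p ((x₁ : ℚ_[p]) - x₂) := by
    rw [← hmul (hd x₃) (hd x₄), hdenp, hmul (mul_ne_zero (pow_ne_zero 2 (hd x₁))
      (pow_ne_zero 2 (hd x₂))) (pow_ne_zero 2 hδ), hmul (pow_ne_zero 2 (hd x₁))
      (pow_ne_zero 2 (hd x₂)), padicLog_sq (hd x₁), padicLog_sq (hd x₂), padicLog_sq hδ]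
  have hlogS : padicLog p (padicEval Sq (-(x₃ : ℚ_[p]) / y₃)) +
      padicLog p (padicEval Sq (-(x₄ : ℚ_[p]) / y₄)) =
        2 * padicLog p ((x₁ : ℚ_[p]) - x₂) +
          2 * padicLog p (padicEval Sq (-(x₁ : ℚ_[p]) / y₁)) +
          2 * padicLog p (padicEval Sq (-(x₂ : ℚ_[p]) / y₂)) := by
    rw [← hmul hS₃ hS₄, hθ', hmul (mul_ne_zero (pow_ne_zero 2 hδ') (pow_ne_zero 2 hS₁))
      (pow_ne_zero 2 hS₂), hmul (pow_ne_zero 2 hδ') (pow_ne_zero 2 hS₁), padicLog_sq hS₁,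
      padicLog_sq hS₂, padicLog_sq hδ', ← neg_sub, padicLog_neg hδ]
  rw [hS, hD, hq x₃ y₃ h₃ hx₃, hq x₄ y₄ h₄ hx₄, hq x₁ y₁ h₁ hx₁, hq x₂ y₂ h₂ hx₂]
  linear_combination hlogd - hlogS

end Parallelogram

/-! ### §4 The height datum of a given pair on the reduction-kernel locus -/

section Existence

variable (W : WeierstrassCurve ℚ) [W.IsElliptic] [W.IsIntegral ℤ] (p : ℕ) [Fact p.Prime]

/-- **Existence of a height datum pinned to the `Σ`-height of a GIVEN pair.** For `W/ℚ` elliptic with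
`ℤ`-integral equation, a prime `p`, a sigma-squared pair `(Σ, c)` of `W ⊗ ℚ_p` and any function `q` on
`E(ℚ)` with `q(O) = 0` and `q(x, y) = log_p den x − log_p Σ(−x/y)` whenever `‖x‖_p > 1`: IF the
reduction-kernel locus `{(x,y) : ‖x‖_p > 1, non-singular reduction everywhere}` is torsion-free (every
`p ≥ 3`; `p = 2` when `a₁ = a₃ = 0`, `not_isOfFinAddOrder_of_one_lt_norm_of_a₁_a₃`), then there is a
symmetric bilinear torsion-vanishing pairing `D : E(ℚ) × E(ℚ) → ℚ_p` with `D(P, P) = q(P)` on that locus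
(parallelogram law `parallelogram_of_pair` extended by `parallelogram_of_generic`, then Jordan–von Neumann
`exists_pairing_of_parallelogram`). The receptacle-free twin of `exists_isCanonicalSq_of_exists` for a
pair that need not be THE chosen one. [Mazur–Stein–Tate 2006, §1 («extends uniquely»), §2.6–2.7;
Stein–Wuthrich 2013, §4.1 eq. (4.1); Silverman 2005, §5 Rem. 2] [cite: MazurSteinTate2006, §2.7] -/
theorem exists_padicHeightData_of_pair {Sq : ℚ_[p]⟦X⟧} {c : ℚ_[p]}
    (hpair : (W.baseChange ℚ_[p]).IsMazurTateSigmaSqPair Sq c) (q : W.toAffine.Point → ℚ_[p])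
    (hq0 : q 0 = 0)
    (hq : ∀ (x y : ℚ) (h : W.toAffine.Nonsingular x y), 1 < ‖(x : ℚ_[p])‖ →
      q (.some x y h) = padicLog p ((x.den : ℚ) : ℚ_[p]) - padicLog p (padicEval Sq (-(x : ℚ_[p]) / y)))
    (htf : ∀ (x y : ℚ) (h : W.toAffine.Nonsingular x y), 1 < ‖(x : ℚ_[p])‖ →
      (∀ ℓ : ℕ, ℓ.Prime → W.HasNonsingularReductionAt ℓ x y) →
        ¬ IsOfFinAddOrder (.some x y h : W.toAffine.Point)) :
    ∃ D : PAdicHeightData W p, ∀ (x y : ℚ) (h : W.toAffine.Nonsingular x y), 1 < ‖(x : ℚ_[p])‖ →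
      (∀ ℓ : ℕ, ℓ.Prime → W.HasNonsingularReductionAt ℓ x y) →
        D.pairing (.some x y h) (.some x y h) = q (.some x y h) := by
  obtain ⟨H, hH⟩ := W.exists_addSubgroup_mem_iff_kernelLocus p
  -- `H` is torsion-free
  have htf' : ∀ P ∈ H, IsOfFinAddOrder P → P = 0 := by
    intro P hP hfin
    rcases (hH P).mp hP with h0 | ⟨x, y, h, rfl, hx, hns⟩
    · exact h0
    · exact (htf x y h hx hns hfin).elim
  -- the full parallelogram law on `H`
  have hfull := Literature.NumberTheory.EllipticCurves.parallelogram_of_generic H htf' q hq0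
    fun P hP Q hQ hP0 hQ0 hPQ hPQ' => by
      rcases (hH P).mp hP with rfl | ⟨x₁, y₁, h₁, rfl, hx₁, hns₁⟩
      · exact (hP0 rfl).elim
      rcases (hH Q).mp hQ with rfl | ⟨x₂, y₂, h₂, rfl, hx₂, hns₂⟩
      · exact (hQ0 rfl).elim
      exact parallelogram_of_pair hpair q hq h₁ h₂ hx₁ hx₂ hns₁ hns₂ hPQ hPQ'
  obtain ⟨B, hsymm, htors, hdiag⟩ :=
    Literature.NumberTheory.EllipticCurves.exists_pairing_of_parallelogram H _ hfull
  exact ⟨⟨B, hsymm, fun P Q hP => htors P Q hP⟩, fun x y h hx hns =>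
    hdiag _ ((hH _).mpr (Or.inr ⟨x, y, h, rfl, hx, hns⟩))⟩

/-- **The same for a model with `a₁ = a₃ = 0`, at every prime including `2`** (torsion-freeness of the
locus supplied by `not_isOfFinAddOrder_of_one_lt_norm_of_a₁_a₃`) — the case of the integral quadratic-twist
models `y² = x³ + A x² + B x + C`. [Mazur–Stein–Tate 2006, §2.7; Silverman 2005, §5 Rem. 2]
[cite: MazurSteinTate2006, §2.7] [cite: Silverman2005DivPoly, §5 Rem. 2] -/
theorem exists_padicHeightData_of_pair_of_a₁_a₃ (ha₁ : W.a₁ = 0) (ha₃ : W.a₃ = 0)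
    {Sq : ℚ_[p]⟦X⟧} {c : ℚ_[p]} (hpair : (W.baseChange ℚ_[p]).IsMazurTateSigmaSqPair Sq c)
    (q : W.toAffine.Point → ℚ_[p]) (hq0 : q 0 = 0)
    (hq : ∀ (x y : ℚ) (h : W.toAffine.Nonsingular x y), 1 < ‖(x : ℚ_[p])‖ →
      q (.some x y h) = padicLog p ((x.den : ℚ) : ℚ_[p]) - padicLog p (padicEval Sq (-(x : ℚ_[p]) / y))) :
    ∃ D : PAdicHeightData W p, ∀ (x y : ℚ) (h : W.toAffine.Nonsingular x y), 1 < ‖(x : ℚ_[p])‖ →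
      (∀ ℓ : ℕ, ℓ.Prime → W.HasNonsingularReductionAt ℓ x y) →
        D.pairing (.some x y h) (.some x y h) = q (.some x y h) :=
  W.exists_padicHeightData_of_pair p hpair q hq0 hq fun _ _ h hx _ =>
    not_isOfFinAddOrder_of_one_lt_norm_of_a₁_a₃ ha₁ ha₃ h hx

end Existence

end WeierstrassCurve
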